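import Summits.QuantumAdvantage.QuantumAdvantage.Theorems.ArithStatLadderDigitRungComposition
import Literature.NumberTheory.CubicFields.ThreeTorsionMeanDecomposition
import Literature.NumberTheory.CubicFields.ThreeTorsionSumFirstOrder

/-!
# `DigitRung` (stmt-QuantumAdvantage-15008, ex 2423), line `Sketch` — the open kernel in cubic-field / orbit form

The one unproved input of the landed composition `digitRung_of_torsWeyl`
(`ArithStatLadderDigitRungComposition.lean`) is the `#Cl₃`-weighted Weyl-sum bound (`stub_torsWeyl`):
`k·‖Σ_{d ∈ 𝒟_n} #Cl₃(−d)·e(d r/2^k)‖ ≤ ε·#𝒟_n` for odd `r`, `K₀(ε) ≤ k ≤ 7n/10 + 1`, eventually.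
Its weight lives on quadratic fields; the object every attack works with (the nine idea cards of
`Cruxes/DigitRung/Ideas`, the refuter's numerics §8b) is the Weyl sum over complex CUBIC FIELDS /
`GL₂(ℤ)`-orbits of irreducible integral binary cubic forms by discriminant. This file moves the kernel
there, using only tree material:

* `torsWeyl_of_cubicFieldWeyl` — by the class-field-theoretic dictionary `#Cl₃(D) = 2·#{cubic fields
  of disc D} + 1` on fundamental `D` (Hasse 1930; the tree's NAMED FACT
  `threeTorsion_eq_two_mul_cubicFieldCountOfDisc_add_one`) and the LANDED unweighted bound
  `stub_fundWeyl`, the `#Cl₃`-weighted bound follows from the same bound for the weight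
  `cubicFieldCountOfDisc (−d)` = the number of cubic fields of discriminant `−d`:
  `T = 2·C + F` termwise on `𝒟_n`;
* `sum_cubicFieldCount_eq_sum_card_irredOrbits` — on `𝒟_n` that weight equals
  `Nat.card (irredOrbitsOfDisc (−d))`, the number of `GL₂(ℤ)`-orbits of irreducible integral binary
  cubic forms of discriminant `−d` (PROVED in the tree for fundamental discriminants:
  `cubicFieldCountOfDisc_eq_card_irredOrbitsOfDisc`, Delone–Faddeev + maximality), so the kernel is a
  Weyl sum over orbits of binary cubic forms — the geometry-of-numbers object (what remains between it
  and a box/fibre sum such as the landed `stub_fibreWeyl` is reduction theory: one representative per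
  orbit in a fundamental domain, the cusp, and the restriction to fundamental discriminants);
* `digitRung_of_cubicFieldWeyl`, `digitRung_of_orbitWeyl` — `DigitRung` from the cubic-field
  (resp. orbit) Weyl input, the dictionary, `btt_threeTorsion_sum` and `EndJuntaRung`.
-/

noncomputable section

namespace Summit.QuantumAdvantage.DigitRung.Sketch

open scoped Classical FourierTransform
open Filter Finset
open Literature.NumberTheory.QuadraticFields Literature.NumberTheory.CubicFields
open Summit.QuantumAdvantage.DigitRung.Negative
open Summit.QuantumAdvantage.QuantumAdvantage.Theses.ArithStatLadder (DigitRung EndJuntaRung)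

namespace OrbitWeyl

/-- On the block `𝒟_n` the dictionary reads `t(−d) = 2·c(−d) + 1` termwise, so the `#Cl₃`-weighted
Weyl sum is `2·(cubic-field-weighted sum) + (unweighted sum)`. [folklore] -/
theorem torsSum_eq (hdict : threeTorsion_eq_two_mul_cubicFieldCountOfDisc_add_one) (n k r : ℕ) :
    (∑ d ∈ block n, (quadFieldThreeTorsion (-(d:ℤ)) : ℂ) * (𝐞 ((d : ℝ) * ((r : ℝ) / 2 ^ k)) : ℂ)) =
      2 * (∑ d ∈ block n, (cubicFieldCountOfDisc (-(d:ℤ)) : ℂ) *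
          (𝐞 ((d : ℝ) * ((r : ℝ) / 2 ^ k)) : ℂ)) +
        ∑ d ∈ block n, (𝐞 ((d : ℝ) * ((r : ℝ) / 2 ^ k)) : ℂ) := by
  rw [Finset.mul_sum, ← Finset.sum_add_distrib]
  refine Finset.sum_congr rfl fun d hd => ?_
  rw [hdict (-(d:ℤ)) (mem_block.mp hd).2]
  push_cast
  ring

/-- On the block `𝒟_n` (fundamental `−d`) the number of cubic fields of discriminant `−d` is the
number of `GL₂(ℤ)`-orbits of irreducible integral binary cubic forms of discriminant `−d`, so the two
weighted Weyl sums coincide. [folklore] -/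
theorem sum_cubicFieldCount_eq_sum_card_irredOrbits (n k r : ℕ) :
    (∑ d ∈ block n, (cubicFieldCountOfDisc (-(d:ℤ)) : ℂ) * (𝐞 ((d : ℝ) * ((r : ℝ) / 2 ^ k)) : ℂ)) =
      ∑ d ∈ block n, (Nat.card (irredOrbitsOfDisc (-(d:ℤ))) : ℂ) *
        (𝐞 ((d : ℝ) * ((r : ℝ) / 2 ^ k)) : ℂ) := by
  refine Finset.sum_congr rfl fun d hd => ?_
  rw [cubicFieldCountOfDisc_eq_card_irredOrbitsOfDisc (mem_block.mp hd).2]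

end OrbitWeyl

open OrbitWeyl

/-- **The `#Cl₃`-weighted Weyl input from the cubic-field-weighted one.** Under Hasse's dictionary
(named fact), the bound `k·‖Σ_{d ∈ 𝒟_n} #{cubic fields of disc −d}·e(d r/2^k)‖ ≤ ε·#𝒟_n` (odd `r`,
`K₀(ε) ≤ k ≤ 7n/10 + 1`, eventually) implies the statement of the registered kernel `stub_torsWeyl`;
the unweighted remainder is the landed `stub_fundWeyl`. [folklore] -/
theorem torsWeyl_of_cubicFieldWeyl (hdict : threeTorsion_eq_two_mul_cubicFieldCountOfDisc_add_one)
    (hC : ∀ ε : ℝ, 0 < ε → ∃ K₀ : ℕ, ∀ᶠ n : ℕ in atTop, ∀ k r : ℕ, K₀ ≤ k → 10 * k ≤ 7 * n + 10 →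
      Odd r → r < 2 ^ k →
      (k : ℝ) * ‖∑ d ∈ block n, (cubicFieldCountOfDisc (-(d:ℤ)) : ℂ) *
          (𝐞 ((d : ℝ) * ((r : ℝ) / 2 ^ k)) : ℂ)‖ ≤ ε * ((block n).card : ℝ)) :
    ∀ ε : ℝ, 0 < ε → ∃ K₀ : ℕ, ∀ᶠ n : ℕ in atTop, ∀ k r : ℕ, K₀ ≤ k → 10 * k ≤ 7 * n + 10 →
      Odd r → r < 2 ^ k →
      (k : ℝ) * ‖∑ d ∈ block n, (quadFieldThreeTorsion (-(d:ℤ)) : ℂ) *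
          (𝐞 ((d : ℝ) * ((r : ℝ) / 2 ^ k)) : ℂ)‖ ≤ ε * ((block n).card : ℝ) := by
  intro ε hε
  obtain ⟨K₀, hK₀⟩ := hC (ε / 3) (by positivity)
  refine ⟨max K₀ 5, ?_⟩
  filter_upwards [hK₀, stub_fundWeyl (ε / 3) (by positivity)] with n hCn hFn k r hk hkn hro hr
  have hk₀ : K₀ ≤ k := (le_max_left K₀ 5).trans hk
  have hk5 : 5 ≤ k := (le_max_right K₀ 5).trans hk
  set C : ℂ := ∑ d ∈ block n, (cubicFieldCountOfDisc (-(d:ℤ)) : ℂ) *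
    (𝐞 ((d : ℝ) * ((r : ℝ) / 2 ^ k)) : ℂ) with hCdef
  set F : ℂ := ∑ d ∈ block n, (𝐞 ((d : ℝ) * ((r : ℝ) / 2 ^ k)) : ℂ) with hFdef
  have hC' : (k : ℝ) * ‖C‖ ≤ ε / 3 * ((block n).card : ℝ) := hCn k r hk₀ hkn hro hr
  have hF' : (k : ℝ) * ‖F‖ ≤ ε / 3 * ((block n).card : ℝ) := hFn k r hk5 hkn hro hr
  have hk0 : (0 : ℝ) ≤ k := Nat.cast_nonneg _
  rw [torsSum_eq hdict n k r]
  calc (k : ℝ) * ‖2 * C + F‖ ≤ (k : ℝ) * (2 * ‖C‖ + ‖F‖) := by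
        gcongr
        calc ‖2 * C + F‖ ≤ ‖2 * C‖ + ‖F‖ := norm_add_le _ _
          _ = 2 * ‖C‖ + ‖F‖ := by rw [norm_mul, Complex.norm_ofNat]
    _ = 2 * ((k : ℝ) * ‖C‖) + (k : ℝ) * ‖F‖ := by ring
    _ ≤ 2 * (ε / 3 * ((block n).card : ℝ)) + ε / 3 * ((block n).card : ℝ) := by gcongr
    _ = ε * ((block n).card : ℝ) := by ring

/-- **The `#Cl₃`-weighted Weyl input from the orbit-weighted one.** The same with the weight
`Nat.card (irredOrbitsOfDisc (−d))` = the number of `GL₂(ℤ)`-orbits of irreducible integral binary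
cubic forms of discriminant `−d` (equal to the number of cubic fields on fundamental `−d`, proved in
the tree). [folklore] -/
theorem torsWeyl_of_orbitWeyl (hdict : threeTorsion_eq_two_mul_cubicFieldCountOfDisc_add_one)
    (hO : ∀ ε : ℝ, 0 < ε → ∃ K₀ : ℕ, ∀ᶠ n : ℕ in atTop, ∀ k r : ℕ, K₀ ≤ k → 10 * k ≤ 7 * n + 10 →
      Odd r → r < 2 ^ k →
      (k : ℝ) * ‖∑ d ∈ block n, (Nat.card (irredOrbitsOfDisc (-(d:ℤ))) : ℂ) *
          (𝐞 ((d : ℝ) * ((r : ℝ) / 2 ^ k)) : ℂ)‖ ≤ ε * ((block n).card : ℝ)) :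
    ∀ ε : ℝ, 0 < ε → ∃ K₀ : ℕ, ∀ᶠ n : ℕ in atTop, ∀ k r : ℕ, K₀ ≤ k → 10 * k ≤ 7 * n + 10 →
      Odd r → r < 2 ^ k →
      (k : ℝ) * ‖∑ d ∈ block n, (quadFieldThreeTorsion (-(d:ℤ)) : ℂ) *
          (𝐞 ((d : ℝ) * ((r : ℝ) / 2 ^ k)) : ℂ)‖ ≤ ε * ((block n).card : ℝ) := by
  refine torsWeyl_of_cubicFieldWeyl hdict fun ε hε => ?_
  obtain ⟨K₀, hK₀⟩ := hO ε hε
  refine ⟨K₀, ?_⟩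
  filter_upwards [hK₀] with n hn k r hk hkn hro hr
  rw [sum_cubicFieldCount_eq_sum_card_irredOrbits]
  exact hn k r hk hkn hro hr

/-- **`DigitRung` from the cubic-field Weyl input**, Hasse's dictionary, `btt_threeTorsion_sum` and
`EndJuntaRung`. [folklore] -/
theorem digitRung_of_cubicFieldWeyl (hdict : threeTorsion_eq_two_mul_cubicFieldCountOfDisc_add_one)
    (hC : ∀ ε : ℝ, 0 < ε → ∃ K₀ : ℕ, ∀ᶠ n : ℕ in atTop, ∀ k r : ℕ, K₀ ≤ k → 10 * k ≤ 7 * n + 10 →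
      Odd r → r < 2 ^ k →
      (k : ℝ) * ‖∑ d ∈ block n, (cubicFieldCountOfDisc (-(d:ℤ)) : ℂ) *
          (𝐞 ((d : ℝ) * ((r : ℝ) / 2 ^ k)) : ℂ)‖ ≤ ε * ((block n).card : ℝ))
    (hbtt : btt_threeTorsion_sum) (hEJ : EndJuntaRung) : DigitRung :=
  digitRung_of_torsWeyl (torsWeyl_of_cubicFieldWeyl hdict hC) hbtt hEJ

/-- **`DigitRung` from the orbit Weyl input** (Weyl sums over `GL₂(ℤ)`-orbits of irreducible
integral binary cubic forms with `−Disc ∈ 𝒟_n`), Hasse's dictionary, `btt_threeTorsion_sum` and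
`EndJuntaRung`. [folklore] -/
theorem digitRung_of_orbitWeyl (hdict : threeTorsion_eq_two_mul_cubicFieldCountOfDisc_add_one)
    (hO : ∀ ε : ℝ, 0 < ε → ∃ K₀ : ℕ, ∀ᶠ n : ℕ in atTop, ∀ k r : ℕ, K₀ ≤ k → 10 * k ≤ 7 * n + 10 →
      Odd r → r < 2 ^ k →
      (k : ℝ) * ‖∑ d ∈ block n, (Nat.card (irredOrbitsOfDisc (-(d:ℤ))) : ℂ) *
          (𝐞 ((d : ℝ) * ((r : ℝ) / 2 ^ k)) : ℂ)‖ ≤ ε * ((block n).card : ℝ))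
    (hbtt : btt_threeTorsion_sum) (hEJ : EndJuntaRung) : DigitRung :=
  digitRung_of_torsWeyl (torsWeyl_of_orbitWeyl hdict hO) hbtt hEJ

end Summit.QuantumAdvantage.DigitRung.Sketch

end
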